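import Summits.BirchSwinnertonDyer.BirchSwinnertonDyer.Theorems.SchneiderFreeAdditiveX3KrizLiHypothesisOneAutomaticDoor
import Literature.NumberTheory.EllipticCurves.RationalIsogenyPrimeDegreeJInvariants
import Literature.NumberTheory.EllipticCurves.Fouquet2025.Assumption34TwistLocusProofs
import HarnessLib

/-!
# The `p = 37` row of the K1 door: an integral `j`-invariant (Mazur's table: `j ∈ {−7·11³, −7·137³·2083³}`) excludes every multiplicative
# prime, so Kriz–Li's hypothesis (2) is AUTOMATIC there as well — on that row the Kriz–Li road to the lower half of BSD₃₇ needs only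
# `PrintedFacts`, Kriz–Li Thm. 1.20, Mazur's `j`-table and the Bernoulli pair (route `SchneiderFreeAdditiveX3`, Kriz–Li corner)

Cell `bsd-schneider-ideate`, seat `bsd-schneider-door-c5` (prover, generation 37; `--supports` 19177 as helper).  PARTITION: board row
B6 ∩ X3 ∩ sst-twist, `r = 1`, the `p = 37` row (EMPTY in the census `N < 5·10⁵`; class-wide: the quadratic twists of the two `X₀(37)` modulus
curves, generation 35's `KYBranchThirtySevenRow`) — one of the five primes at which crux r3 has content (`KYBranchRowPrimes`); types-the-object-of
nothing new; closes nothing; BSD NOT advanced; «closes rung: none».  bears_on: K1-door (19177).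

WHY.  By this seat's `KrizLiOneAutomaticDoor.missingLowerBoundAt_of_printedFacts_of_thm120_of_forall_bernoulli_five_le` (p746121) the Kriz–Li
road on the door at `p ≥ 5` needs per pair only (2) «no split multiplicative prime» and the Bernoulli pair (4).  On the `p = 37` row (2) is
itself a theorem: a rational `37`-isogeny forces `j(W) ∈ {−9317, −162677523113838677}` (Mazur 1978, the tree's named fact
`mazur_j_mem_of_not_hasIrreducibleModPGaloisRep_of_eleven_le`, displayed), an INTEGER, while at a multiplicative prime `q` one has
`v_q(j) = −v_q(Δ_min) < 0` (tree `Fouquet2025.padicValRat_j_of_hasMultiplicativeReductionAtPrime`, Silverman VII.5.1).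

WHAT.  §1 `not_hasMultiplicativeReductionAtPrime_of_j_eq_intCast` (UNCONDITIONAL: integral `j` ⟹ no multiplicative prime); §2
`not_hasMultiplicativeReductionAtPrime_of_red_thirtySeven`, `not_hasSplitMultiplicativeReductionAtPrime_of_classX3_thirtySeven` (under Mazur's
displayed table); §3 **`missingLowerBoundAt_thirtySeven_of_printedFacts_of_thm120_of_forall_bernoulli`** — for `W` globally minimal with
`r_an(W) = 1`, `ClassX3 W 37`, semistable twist at `37`: the lower half of BSD₃₇ from `PrintedFacts` + Kriz–Li Thm. 1.20 + Mazur's table +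
«for every admissible character datum (`37 ∣ f`): a Heegner field with odd `d_K`, its Kronecker character and the Bernoulli pair (4)».  So on
this row the crux's `p = 37` instance (Keller–Yin, PREPRINT) has a PUBLISHED alternative modulo an explicit Bernoulli non-vanishing.

HONEST FRAMING: §1 unconditional; §2–§3 CONDITIONAL on the displayed named facts (Mazur's `j`-table, `PrintedFacts`, Kriz–Li Thm. 1.20 — all
PUBLISHED) and on the per-pair Bernoulli hypothesis, whose class-wide supply is NOT claimed; nothing is closed; BSD is proved for no curve;
«closes rung: none».  References: [Mazur1978] Thm. 1, table p. 129; [SilvermanAEC2009] VII.5 Prop. 5.1(b); [KrizLi2019] Thm. 1.20;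
[Zywina2015] §4.8; this seat p746121, p739941 (generation 35, `KYBranchThirtySevenRow`).
-/

set_option autoImplicit false
-- `Summit.<P>.<Sub>` repeats `BirchSwinnertonDyer` by the tree's layout convention (D-0017)
set_option linter.dupNamespace false

noncomputable section

open scoped Classical NumberField

open NumberField WeierstrassCurve Literature.NumberTheory.EllipticCurves Literature.NumberTheory.EllipticCurves.KrizLi2019

namespace Summit.BirchSwinnertonDyer.BirchSwinnertonDyer.Theorems.SchneiderFreeAdditiveX3.KrizLiThirtySevenRow

/-! ### §1 An integral `j`-invariant excludes multiplicative reduction -/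

/-- **An integral `j`-invariant excludes multiplicative reduction.**  For `W/ℚ` globally minimal elliptic with `j(W) = n ∈ ℤ`, no prime `q`
is multiplicative for `W`: at a multiplicative `q`, `q ∣ Δ_min` and `v_q(j) = −v_q(Δ_min) ≤ −1` (`j = c₄³/Δ_min`, `q ∤ c₄`), whereas
`v_q(n) ≥ 0`. [cite: SilvermanAEC2009, VII.5 Prop. 5.1(b)] [cite: SilvermanATAEC1994, Ch. V Lemma 5.1] -/
theorem not_hasMultiplicativeReductionAtPrime_of_j_eq_intCast (W : WeierstrassCurve ℚ) [W.IsElliptic] [W.IsGloballyMinimal]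
    {n : ℤ} (hj : W.j = (n : ℚ)) (q : ℕ) [hq : Fact q.Prime] : ¬ W.HasMultiplicativeReductionAtPrime q := by
  intro hmult
  have hv := Fouquet2025.padicValRat_j_of_hasMultiplicativeReductionAtPrime W q hmult
  have hdvd : (q : ℤ) ∣ W.minimalDiscriminantInt := (LocalTorsionMult.dvd_Δ_and_not_dvd_c₄_integralModelInt_of_mult W q hmult).1
  have hΔ0 : W.minimalDiscriminantInt ≠ 0 := minimalDiscriminantInt_ne_zero W
  have hpos : 1 ≤ padicValInt q W.minimalDiscriminantInt := by
    rcases (padicValInt_dvd_iff 1 W.minimalDiscriminantInt).mp (by rw [pow_one]; exact hdvd) with h0 | h1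
    · exact absurd h0 hΔ0
    · exact h1
  have hnonneg : 0 ≤ padicValRat q W.j := by
    rw [hj, padicValRat.of_int]; exact_mod_cast Nat.zero_le _
  rw [hv] at hnonneg
  omega

/-! ### §2 The `p = 37` row: `j ∈ {−7·11³, −7·137³·2083³}` (Mazur), so no multiplicative prime, so Kriz–Li's (2) holds -/

open Literature.NumberTheory.EllipticCurves.Rank1Residual in
/-- **A curve with a rational `37`-isogeny has no multiplicative prime** (Mazur's `j`-table, displayed as the named fact `hJ`: `j ∈
{−9317, −162677523113838677}`, both integers; then §1). [cite: Mazur1978, Thm. 1 and table p. 129] [cite: Zywina2015, §4.8] -/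
theorem not_hasMultiplicativeReductionAtPrime_of_red_thirtySeven (hJ : mazur_j_mem_of_not_hasIrreducibleModPGaloisRep_of_eleven_le)
    (W : WeierstrassCurve ℚ) [W.IsElliptic] [W.IsGloballyMinimal] [Fact (Nat.Prime 37)]
    (hred : ¬ W.HasIrreducibleModPGaloisRep 37) (q : ℕ) [Fact q.Prime] : ¬ W.HasMultiplicativeReductionAtPrime q := by
  have h := hJ W 37 (by norm_num) (by norm_num) hred
  rcases h with ⟨h11, -⟩ | ⟨h17, -⟩ | ⟨h19, -⟩ | ⟨-, hj⟩ | ⟨h43, -⟩ | ⟨h67, -⟩ | ⟨h163, -⟩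
  · norm_num at h11
  · norm_num at h17
  · norm_num at h19
  · rcases hj with hj | hj
    · exact not_hasMultiplicativeReductionAtPrime_of_j_eq_intCast W (n := -9317) (by rw [hj]; norm_num) q
    · exact not_hasMultiplicativeReductionAtPrime_of_j_eq_intCast W (n := -162677523113838677) (by rw [hj]; norm_num) q
  · norm_num at h43
  · norm_num at h67
  · norm_num at h163

open Literature.NumberTheory.EllipticCurves.Rank1Residual in
/-- **Kriz–Li's hypothesis (2) on the `p = 37` row:** for `W` globally minimal with `ClassX3 W 37` (so `E[37]` reducible), no prime is split
multiplicative (indeed none is multiplicative), under Mazur's displayed table. [cite: Mazur1978, Thm. 1 and table p. 129]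
[cite: KrizLi2019, Thm. 1.20 hypothesis (2) (p. 7)] -/
theorem not_hasSplitMultiplicativeReductionAtPrime_of_classX3_thirtySeven
    (hJ : mazur_j_mem_of_not_hasIrreducibleModPGaloisRep_of_eleven_le)
    (W : WeierstrassCurve ℚ) [W.IsElliptic] [W.IsGloballyMinimal] [Fact (Nat.Prime 37)] (hX : ClassX3 W 37) :
    ∀ ℓ : ℕ, (hℓ : ℓ.Prime) → ¬ (haveI := Fact.mk hℓ; W.HasSplitMultiplicativeReductionAtPrime ℓ) := by
  intro ℓ hℓ hsplit
  haveI := Fact.mk hℓ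
  exact not_hasMultiplicativeReductionAtPrime_of_red_thirtySeven hJ W hX.1 ℓ hsplit.hasMultiplicativeReductionAtPrime

/-! ### §3 The Kriz–Li road on the `p = 37` row: `PrintedFacts` + Thm. 1.20 + Mazur's table + the Bernoulli pair ONLY -/

open Summit.BirchSwinnertonDyer.Rank1Residual Literature.NumberTheory.EllipticCurves.Rank1Residual
  Literature.NumberTheory.EllipticCurves.Rank1Residual.Typed
  Summit.BirchSwinnertonDyer.BirchSwinnertonDyer.Theses.SchneiderFreeAdditiveX3 in
/-- **The Kriz–Li road on the `p = 37` row of the K1 door: only the Bernoulli pair remains.**  For `W/ℚ` globally minimal with `r_an(W) = 1`,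
`ClassX3 W 37` and `SubSemistableTwist W 37`: if for every admissible Kriz–Li character datum `(f, ψ, ω)` of `W` at `37` (primitive `ψ`,
Teichmüller `ω`, `f` supported on `37·N_W`, trace form, `37 ∣ f`) there are an imaginary quadratic Heegner field `K` of `N_W` with odd `d_K`,
its Kronecker character and the Bernoulli pair (4) `B_{1,ψ₀⁻¹ε_K}·B_{1,ψ₀ω⁻¹} ≢ 0 (mod 37)`, then `MissingLowerBoundAt W 37` (the lower half of
BSD₃₇) — by `KrizLiOneAutomaticDoor.missingLowerBoundAt_of_printedFacts_of_thm120_of_forall_bernoulli_five_le` ((1), (3) automatic) with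
(2) from §2.  CONDITIONAL on `hF` (`PrintedFacts`), `hKL` (Kriz–Li Thm. 1.20), `hJ` (Mazur's table) — all PUBLISHED — and the Bernoulli
hypothesis; closes nothing by name; BSD is NOT advanced. [cite: KrizLi2019, Thm. 1.20 (pp. 7–8)] [cite: Mazur1978, Thm. 1 and table p. 129]
[cite: GrossZagier1986, Thm. I.(6.3)] -/
theorem missingLowerBoundAt_thirtySeven_of_printedFacts_of_thm120_of_forall_bernoulli (hF : PrintedFacts)
    (hKL : KrizLi2019.thm120_padicLogHeegner_unit_of_bernoulli) (hJ : mazur_j_mem_of_not_hasIrreducibleModPGaloisRep_of_eleven_le)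
    (W : WeierstrassCurve ℚ) [W.IsElliptic] [W.IsGloballyMinimal] [Fact (Nat.Prime 37)]
    (hr : W.analyticRank = 1) (hX : ClassX3 W 37) (hS : Additive.SubSemistableTwist W 37)
    (hdat : ∀ (f : ℕ) [NeZero f] (ψ : DirichletCharacter ℚ_[37] f) (ω : DirichletCharacter ℚ_[37] 37),
      ψ.IsPrimitive → IsTeichmullerCharacter ω → (∀ q : ℕ, q.Prime → q ∣ f → q ∣ 37 * W.conductorNorm ℤ) →
      (∀ ℓ : ℕ, ℓ.Prime → ¬ (ℓ ∣ 37 * W.conductorNorm ℤ) →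
        ‖((W.LFunction ℓ : ℤ) : ℚ_[37]) - (ψ (ℓ : ZMod f) + ψ⁻¹ (ℓ : ZMod f) * ω (ℓ : ZMod 37))‖ < 1) →
      37 ∣ f →
      ∃ (K : Type) (_ : Field K) (_ : NumberField K) (εK : DirichletCharacter ℚ_[37] (NumberField.discr K).natAbs),
        IsImaginaryQuadratic K ∧ Odd (NumberField.discr K) ∧ SatisfiesHeegnerHypothesis (W.conductorNorm ℤ) K ∧
        IsKroneckerCharacterOf K εK ∧
        ¬ (‖bernoulliOnePrim (bernoulliCharOne ψ εK) * bernoulliOnePrim (bernoulliCharTwo ψ εK ω)‖ ≤ ((37 : ℕ) : ℝ)⁻¹)) :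
    MissingLowerBoundAt W 37 :=
  KrizLiOneAutomaticDoor.missingLowerBoundAt_of_printedFacts_of_thm120_of_forall_bernoulli_five_le hF hKL W 37 hr (by norm_num) hX hS
    (not_hasSplitMultiplicativeReductionAtPrime_of_classX3_thirtySeven hJ W hX) hdat

end Summit.BirchSwinnertonDyer.BirchSwinnertonDyer.Theorems.SchneiderFreeAdditiveX3.KrizLiThirtySevenRow

end
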